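import Literature.NumberTheory.LFunctions.LiouvilleSieve

/-!
# Certified computation of `L(x) = ∑_{n ≤ x} λ(n)`, last block: `905990400 ≤ n ≤ 906150256`

One compiled evaluation (`native_decide`) of `Literature.RH.LiouvilleSieve.checkLast (-553)`; see
`Literature/NumberTheory/LFunctions/LiouvilleSieve.lean` (`checkLast_spec`). In words: starting
from `L(905990399) = -553`, `L(n) ≤ 0` for `905990400 ≤ n ≤ 906150256` and `L(906150256) = 0`
[Tanaka1980, p. 187: "L(x) = 0 for 54 values of x, the first of which is 906150256"].
The only non-standard axiom of this file is the `native_decide` auxiliary axiom of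
`checkLast_856` (trust in the Lean compiler, the `Lean.ofReduceBool` / `Lean.trustCompiler`
family), declared to the gate as `computational`.
-/

namespace Literature.NumberTheory.LFunctions.LiouvilleSieve

/-- Last block of the certified computation behind Tanaka's result:
`checkLast (-553) = true`, i.e. `L(n) ≤ 0` for `905990400 ≤ n ≤ 906150256` and
`L(906150256) = 0`, given `L(905990399) = -553`. [cite: Tanaka1980, pp. 187–188] -/
theorem checkLast_856 : checkLast (-553) = true := by
  native_decide

end Literature.NumberTheory.LFunctions.LiouvilleSieve
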